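import Summits.CriticalPhenomena.SAWScalingLimit.Theorems.SAWDevelopingMapObservableToSLETypeLadderCarvedReductionSqueezeHull
import Literature.Probability.RandomPlanarGeometry.HullSubdomainPullback
import Literature.Probability.RandomPlanarGeometry.HullThickening
import HarnessLib

/-!
# The `*`-hull `A = cl(ℍ ∖ φ⁻¹Ω)` of the limit bulk (piece (T-A′₂ hull) of stub T-A′₂
# `stub_carvedReduction_squeezeGeometry_domainsCore`)

Crux `SAWDevelopingMap.ObservableToSLE` (stmt-CriticalPhenomena-10472), line `six-class-type-ladder`,
stub T-A′₂ `stub_carvedReduction_squeezeGeometry_domainsCore`.  Landing target: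
`Summits/CriticalPhenomena/SAWScalingLimit/Theorems/SAWDevelopingMapObservableToSLETypeLadderCarvedReductionSqueezeBulkHull.lean`.

The frame `Squeeze.stub_carvedReduction_derivFrame` (p129409) and the inner-approximant contract
(p144792) are stated over the hull `A := closure (ℍ ∖ φ.symm '' Ω)` of the limit bulk `Ω ⊆ E`
(`E` the super-domain with chordal uniformizer `φ`), and the frame needs `IsStarHull A`,
`A.Nonempty`.  `bulkHull` derives these from ELEMENTARY properties of `Ω`: open, connected,
containing the germs of `E` at both marked points, with connected complement — through
`TypeLadder.stub_carvedReduction_hullOfDomain` (p129374).  The one non-formal input of that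
theorem, ATTACHEDNESS of `ℍ ∖ φ⁻¹Ω` to the real axis, is `isConnected_compl_preimage_union`:
a closed separation of `(ℍ ∖ φ⁻¹Ω) ∪ {im ≤ 0}` would cut out of `ℍ ∖ φ⁻¹Ω` a COMPACT piece whose
`φ`-image is a nonempty proper relatively clopen subset of the connected `Ωᶜ`.
Also recorded: the half-disc at `0` and the far field lie in `φ⁻¹Ω` (chordal boundary values),
`ℍ ∖ A = φ⁻¹Ω`, `A ∩ ℍ = ℍ ∖ φ⁻¹Ω`.
Registered carrier: `stub_carvedReduction_bulkHull`.
-/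

noncomputable section

open scoped Topology
open Filter Set Metric Bornology
open UpperHalfPlane (upperHalfPlaneSet isOpen_upperHalfPlaneSet)
open Literature.Probability.RandomPlanarGeometry

namespace Summit.CriticalPhenomena.SAWScalingLimit.Theorems.ObservableToSLE.TypeLadder

section Hull

variable {E : DobrushinDomain} {φ : ConformalEquiv upperHalfPlaneSet E.carrier} {Ω : Set ℂ}

/-- Membership in `φ⁻¹Ω = φ.symm '' Ω` for points of `ℍ`. -/
theorem mem_symm_image_iff (hΩE : Ω ⊆ E.carrier) {z : ℂ} (hz : z ∈ upperHalfPlaneSet) :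
    z ∈ φ.symm '' Ω ↔ φ z ∈ Ω := by
  constructor
  · rintro ⟨o, ho, rfl⟩; rwa [φ.apply_symm_apply (hΩE ho)]
  · exact fun h => ⟨φ z, h, φ.symm_apply_apply hz⟩

/-- `φ⁻¹Ω ⊆ ℍ`. -/
theorem symm_image_subset (hΩE : Ω ⊆ E.carrier) : φ.symm '' Ω ⊆ upperHalfPlaneSet :=
  fun _ ⟨_, ho, h⟩ => h ▸ φ.symm_mapsTo (hΩE ho)

/-- **The half-disc at `0` lies in `φ⁻¹Ω`** when `Ω` contains the germ of `E` at `E.pt 0`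
(chordal boundary value of `φ` at `0`). -/
theorem exists_ball_inter_subset (hφ : E.IsChordalUniformizing φ) (hΩE : Ω ⊆ E.carrier)
    (hwin : ∃ W ∈ 𝓝 (E.pt 0), W ∩ E.carrier ⊆ Ω) :
    ∃ r > (0 : ℝ), upperHalfPlaneSet ∩ ball 0 r ⊆ φ.symm '' Ω := by
  obtain ⟨W, hW, hWΩ⟩ := hwin
  have hev : ∀ᶠ z in 𝓝[upperHalfPlaneSet] 0, φ z ∈ W := hφ.1 hW
  rw [eventually_nhdsWithin_iff, Metric.eventually_nhds_iff] at hev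
  obtain ⟨r, hr, h⟩ := hev
  refine ⟨r, hr, fun z ⟨hz, hzr⟩ => (mem_symm_image_iff hΩE hz).2 (hWΩ ⟨h (mem_ball.1 hzr) hz, φ.mapsTo hz⟩)⟩

/-- **The far field lies in `φ⁻¹Ω`** when `Ω` contains the germ of `E` at `E.pt 1` (chordal
boundary value of `φ` at `∞`). -/
theorem exists_forall_norm_le_mem (hφ : E.IsChordalUniformizing φ) (hΩE : Ω ⊆ E.carrier)
    (hwin : ∃ W ∈ 𝓝 (E.pt 1), W ∩ E.carrier ⊆ Ω) :
    ∃ R : ℝ, ∀ z ∈ upperHalfPlaneSet, R ≤ ‖z‖ → z ∈ φ.symm '' Ω := by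
  obtain ⟨W, hW, hWΩ⟩ := hwin
  have hev : ∀ᶠ z in cocompact ℂ ⊓ 𝓟 upperHalfPlaneSet, φ z ∈ W := hφ.2 hW
  rw [Filter.eventually_inf_principal, ← Metric.cobounded_eq_cocompact] at hev
  obtain ⟨R, -, hR⟩ := (Filter.hasBasis_cobounded_norm.eventually_iff).1 hev
  exact ⟨R, fun z hz hzR => (mem_symm_image_iff hΩE hz).2 (hWΩ ⟨hR hzR hz, φ.mapsTo hz⟩)⟩

/-- **ATTACHEDNESS**: `(ℍ ∖ φ⁻¹Ω) ∪ {im ≤ 0}` is connected, for `Ω ⊆ E` open with connected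
complement containing the germ of `E` at `E.pt 1`. -/
theorem isConnected_compl_preimage_union (hφ : E.IsChordalUniformizing φ) (hΩo : IsOpen Ω)
    (hΩE : Ω ⊆ E.carrier) (hwin : ∃ W ∈ 𝓝 (E.pt 1), W ∩ E.carrier ⊆ Ω) (hΩc : IsConnected Ωᶜ) :
    IsConnected ((upperHalfPlaneSet \ φ.symm '' Ω) ∪ {z : ℂ | z.im ≤ 0}) := by
  set U : Set ℂ := φ.symm '' Ω with hUdef
  set L : Set ℂ := {z : ℂ | z.im ≤ 0} with hLdef
  set Y : Set ℂ := (upperHalfPlaneSet \ U) ∪ L with hYdef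
  have hUo : IsOpen U := φ.symm.isOpen_image isOpen_upperHalfPlaneSet hΩo hΩE
  obtain ⟨R, hR⟩ := exists_forall_norm_le_mem hφ hΩE hwin
  have hLpre : IsPreconnected L := (convex_halfSpace_im_le (r := 0)).isPreconnected
  refine ⟨⟨0, mem_union_right _ (show (0 : ℂ).im ≤ 0 by simp)⟩, ?_⟩
  -- the core: no closed separation `u ⊇ L`, `v ∌ L`-points
  have core : ∀ u v : Set ℂ, IsClosed u → IsClosed v → Y ⊆ u ∪ v → ¬ (Y ∩ (u ∩ v)).Nonempty →
      L ⊆ u → ¬ (Y ∩ v).Nonempty := by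
    intro u v hu hv hcover hempty hLu ⟨b, hbY, hbv⟩
    -- the piece cut out by `v`
    set B : Set ℂ := (upperHalfPlaneSet \ U) ∩ v with hBdef
    have hBY : B ⊆ Y := fun z hz => mem_union_left _ hz.1
    have hbB : b ∈ B := by
      refine ⟨?_, hbv⟩
      rcases hbY with h | h
      · exact h
      · exact absurd ⟨b, Or.inr h, hLu h, hbv⟩ hempty
    have hBu : ∀ z ∈ B, z ∉ u := fun z hz hzu => hempty ⟨z, hBY hz, hzu, hz.2⟩
    -- `B` is compact
    have hBbd : IsBounded B := by
      refine (isBounded_closedBall (x := (0 : ℂ)) (r := R)).subset fun z hz => ?_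
      rw [mem_closedBall, dist_zero_right]
      by_contra hlt
      push Not at hlt
      exact hz.1.2 (hR z hz.1.1 hlt.le)
    have hBcl : IsClosed B := by
      refine isClosed_of_closure_subset fun w hw => ?_
      have hwv : w ∈ v := closure_minimal (fun z hz => hz.2) hv hw
      by_cases hwim : 0 < w.im
      · have hwH : w ∈ upperHalfPlaneSet := hwim
        have hwU : w ∉ U := by
          have hdisj : Disjoint (closure (upperHalfPlaneSet \ U)) U :=
            (Set.disjoint_left.2 fun z hz hzU => hz.2 hzU).closure_left hUo
          exact Set.disjoint_left.1 hdisj (closure_mono (fun z hz => hz.1) hw)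
        exact ⟨⟨hwH, hwU⟩, hwv⟩
      · have hwL : w ∈ L := not_lt.1 hwim
        exact absurd ⟨w, Or.inr hwL, hLu hwL, hwv⟩ hempty
    have hBc : IsCompact B := Metric.isCompact_of_isClosed_isBounded hBcl hBbd
    have hBH : B ⊆ upperHalfPlaneSet := fun z hz => hz.1.1
    -- its image `K ⊆ E ∖ Ω` is compact, hence closed
    set K : Set ℂ := φ '' B with hKdef
    have hKc : IsCompact K := hBc.image_of_continuousOn (φ.continuousOn.mono hBH)
    have hKE : K ⊆ E.carrier := by rintro _ ⟨z, hz, rfl⟩; exact φ.mapsTo (hBH hz)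
    have hKΩ : K ⊆ Ωᶜ := by
      rintro _ ⟨z, hz, rfl⟩ hzΩ
      exact hz.1.2 ((mem_symm_image_iff hΩE (hBH hz)).2 hzΩ)
    -- `K` is open in `Ωᶜ`: a small ball about `z ∈ B` misses `u`, and its image meets `Ωᶜ` inside `K`
    have hloc : ∀ z ∈ B, ∃ ε > (0 : ℝ), ball z ε ⊆ upperHalfPlaneSet ∧ φ '' ball z ε ∩ Ωᶜ ⊆ K := by
      intro z hz
      have h1 : uᶜ ∩ upperHalfPlaneSet ∈ 𝓝 z :=
        Filter.inter_mem (hu.isOpen_compl.mem_nhds (hBu z hz)) (isOpen_upperHalfPlaneSet.mem_nhds (hBH hz))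
      obtain ⟨ε, hε, hball⟩ := Metric.mem_nhds_iff.1 h1
      refine ⟨ε, hε, fun w hw => (hball hw).2, ?_⟩
      rintro _ ⟨⟨w, hw, rfl⟩, hwΩ⟩
      have hwH : w ∈ upperHalfPlaneSet := (hball hw).2
      have hwU : w ∉ U := fun hwU => hwΩ ((mem_symm_image_iff hΩE hwH).1 hwU)
      have hwY : w ∈ Y := mem_union_left _ ⟨hwH, hwU⟩
      have hwv : w ∈ v := (hcover hwY).resolve_left (hball hw).1
      exact ⟨w, ⟨⟨hwH, hwU⟩, hwv⟩, rfl⟩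
    choose! ε hε hεH hεK using hloc
    set Uo : Set ℂ := ⋃ z ∈ B, φ '' ball z (ε z) with hUo'
    have hUoo : IsOpen Uo := isOpen_biUnion fun z hz => φ.isOpen_image E.isOpen isOpen_ball (hεH z hz)
    have hUoK : Uo ∩ Ωᶜ ⊆ K := by
      rintro y ⟨hy, hyΩ⟩
      obtain ⟨z, hz, hyz⟩ := mem_iUnion₂.1 hy
      exact hεK z hz ⟨hyz, hyΩ⟩
    have hKUo : K ⊆ Uo := by
      rintro _ ⟨z, hz, rfl⟩
      exact mem_iUnion₂.2 ⟨z, hz, ⟨z, mem_ball_self (hε z hz), rfl⟩⟩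
    -- the separation of `Ωᶜ` by `Uo` and `Kᶜ`
    obtain ⟨x₀, hx₀⟩ : (E.carrierᶜ).Nonempty := nonempty_compl.2 E.carrier_ne_univ
    obtain ⟨y, hyΩ, hyU, hyK⟩ := hΩc.isPreconnected Uo Kᶜ hUoo hKc.isClosed.isOpen_compl
      (fun w hw => by by_cases h : w ∈ K; exacts [Or.inl (hKUo h), Or.inr h])
      ⟨φ b, hKΩ ⟨b, hbB, rfl⟩, hKUo ⟨b, hbB, rfl⟩⟩ ⟨x₀, fun h => hx₀ (hΩE h), fun h => hx₀ (hKE h)⟩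
    exact hyK (hUoK ⟨hyU, hyΩ⟩)
  rw [isPreconnected_closed_iff]
  intro u v hu hv hcover hYu hYv
  by_contra hempty
  -- `L` lies on one side
  have hLside : L ⊆ u ∨ L ⊆ v := by
    by_contra h
    push Not at h
    obtain ⟨⟨a, haL, hau⟩, ⟨b, hbL, hbv⟩⟩ := And.intro (not_subset.1 h.1) (not_subset.1 h.2)
    have hLcover : L ⊆ u ∪ v := fun z hz => hcover (mem_union_right _ hz)
    -- `a ∈ L ∖ u ⊆ v`, `b ∈ L ∖ v ⊆ u`
    obtain ⟨c, hcL, hcu, hcv⟩ := (isPreconnected_closed_iff.1 hLpre) u v hu hv hLcover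
      ⟨b, hbL, (hLcover hbL).resolve_right hbv⟩ ⟨a, haL, (hLcover haL).resolve_left hau⟩
    exact hempty ⟨c, mem_union_right _ hcL, hcu, hcv⟩
  rcases hLside with hLu | hLv
  · exact core u v hu hv hcover hempty hLu hYv
  · refine core v u hv hu (fun z hz => (union_comm u v) ▸ hcover hz) (fun ⟨z, hzY, hzv, hzu⟩ => hempty ⟨z, hzY, hzu, hzv⟩) hLv hYu

/-- **THE `*`-HULL OF THE LIMIT BULK.**  For the super-domain `E` with chordal uniformizer `φ`
and `Ω ⊆ E` open, connected, containing the germs of `E` at both marked points, with connected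
complement: `A := closure (ℍ ∖ φ.symm '' Ω)` is a `*`-hull with `ℍ ∖ A = φ.symm '' Ω`,
`A ∩ ℍ = ℍ ∖ φ.symm '' Ω`; a half-disc at `0` and the far field lie in `φ.symm '' Ω`; and `A` is
nonempty as soon as `Ω ≠ E`. -/
theorem bulkHull (E : DobrushinDomain) (φ : ConformalEquiv upperHalfPlaneSet E.carrier) (Ω : Set ℂ)
    (hφ : E.IsChordalUniformizing φ) (hΩo : IsOpen Ω) (hΩc : IsConnected Ω) (hΩE : Ω ⊆ E.carrier)
    (hwin : ∀ i : Fin 2, ∃ W ∈ 𝓝 (E.pt i), W ∩ E.carrier ⊆ Ω) (hΩcc : IsConnected Ωᶜ) :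
    IsStarHull (closure (upperHalfPlaneSet \ φ.symm '' Ω)) ∧
      upperHalfPlaneSet \ closure (upperHalfPlaneSet \ φ.symm '' Ω) = φ.symm '' Ω ∧
      closure (upperHalfPlaneSet \ φ.symm '' Ω) ∩ upperHalfPlaneSet = upperHalfPlaneSet \ φ.symm '' Ω ∧
      (∃ r > (0 : ℝ), upperHalfPlaneSet ∩ ball 0 r ⊆ φ.symm '' Ω) ∧
      (∃ R : ℝ, ∀ z ∈ upperHalfPlaneSet, R ≤ ‖z‖ → z ∈ φ.symm '' Ω) ∧
      ((E.carrier \ Ω).Nonempty → (closure (upperHalfPlaneSet \ φ.symm '' Ω)).Nonempty) := by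
  have hUo : IsOpen (φ.symm '' Ω) := φ.symm.isOpen_image isOpen_upperHalfPlaneSet hΩo hΩE
  have hUc : IsConnected (φ.symm '' Ω) := hΩc.image _ (φ.symm.continuousOn.mono hΩE)
  obtain ⟨r, hr, hball⟩ := exists_ball_inter_subset hφ hΩE (hwin 0)
  obtain ⟨R, hR⟩ := exists_forall_norm_le_mem hφ hΩE (hwin 1)
  have hatt := isConnected_compl_preimage_union hφ hΩo hΩE (hwin 1) hΩcc
  obtain ⟨hstar, hdiff, hinter⟩ :=
    stub_carvedReduction_hullOfDomain (φ.symm '' Ω) r R hUo hUc (symm_image_subset hΩE) hr hball hR hatt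
  refine ⟨hstar, hdiff, hinter, ⟨r, hr, hball⟩, ⟨R, hR⟩, ?_⟩
  rintro ⟨o, hoE, hoΩ⟩
  refine ⟨φ.symm o, subset_closure ⟨φ.symm_mapsTo hoE, fun h => hoΩ ?_⟩⟩
  rw [← φ.apply_symm_apply hoE]
  exact (mem_symm_image_iff hΩE (φ.symm_mapsTo hoE)).1 h

end Hull

/-- **Registered carrier `stub_carvedReduction_bulkHull`** (crux item stmt-CriticalPhenomena-10472,
stub T-A′₂ `stub_carvedReduction_squeezeGeometry_domainsCore`, piece THE `*`-HULL OF THE LIMIT BULK):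
the `IsStarHull` and nonemptiness conclusions of `bulkHull`. -/
theorem stub_carvedReduction_bulkHull :
    ∀ (E : DobrushinDomain) (φ : ConformalEquiv upperHalfPlaneSet E.carrier) (Ω : Set ℂ),
      E.IsChordalUniformizing φ → IsOpen Ω → IsConnected Ω → Ω ⊆ E.carrier →
      (∀ i : Fin 2, ∃ W ∈ 𝓝 (E.pt i), W ∩ E.carrier ⊆ Ω) → IsConnected Ωᶜ → (E.carrier \ Ω).Nonempty →
      IsStarHull (closure (upperHalfPlaneSet \ φ.symm '' Ω)) ∧ (closure (upperHalfPlaneSet \ φ.symm '' Ω)).Nonempty :=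
  fun E φ Ω hφ hΩo hΩc hΩE hwin hΩcc hne =>
    let h := bulkHull E φ Ω hφ hΩo hΩc hΩE hwin hΩcc
    ⟨h.1, h.2.2.2.2.2 hne⟩

end Summit.CriticalPhenomena.SAWScalingLimit.Theorems.ObservableToSLE.TypeLadder

end
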